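import Literature.NumberTheory.GaloisRepresentations.HOneRestrictionOntoInvariantsFinite
import Literature.AnabelianGeometry.AbsoluteAnabelian.FreeProcyclicModel
import Mathlib.Topology.Algebra.ClopenNhdofOne
import HarnessLib

/-!
# Tools for the local factor over a `ℤ_p`-tower: inner invariance, open stabilisers, avatars of subgroups, (KM4) for
# torsion coefficients, the `H²`-free extension on a subgroup, and the `⊆` half of
# `im(H¹(P, X) → H¹(N, X)) = {y : ∃ n, φ^{p^n}·y = y}` (abstract profinite form of the structure behind GV 2000 Prop. (2.4);
# line `bridge`, crux `SignedTransportAtTwo`, stmt-BirchSwinnertonDyer-20333, route `ThetaPartnerAtTwo`; lead prover bsd-wall-tp2-p1 g7;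
# `--supports`, route-independent, closes nothing)

HONEST FRAMING. THEOREMS ONLY; no definition; BSD is not proved by any of this. ABSTRACT SETTING: `Γ` a (profinite) topological group, `N ⊴ Γ`, `X` a
topological `Γ`-module (discrete for the stabiliser statements). Contents:

* §1 `conjMap_resLe_eq_of_mem` — classes of `H¹(N, X)` restricted from `H¹(P, X)` (`N ≤ P`) are fixed by every `q ∈ P`
  (inner automorphisms; Serre VII §5 Prop. 3 via the tree's `map_eq_map_of_inner_one`);
  `exists_openNormalSubgroup_forall_conjMap_eq` — for DISCRETE coefficients and compact `N`, every class of `H¹(N, X)` is fixed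
  by an open normal subgroup of `Γ` (finitely many values of a cocycle, uniform local constancy);
* §2 `exists_contOneCocycles_apply_eq_of_primary` — (KM4) for `p`-primary discrete coefficients with finite `p^k`-torsion (from the
  tree's finite case); **`exists_resLe_eq_of_conjMap_eq_subgroup`** — the tree's extension theorem
  `exists_resSubgroup_eq_of_conjMap_eq` run inside a closed subgroup `G' = N ⋊ C` (`C` free procyclic, generator `ψ`): every
  `ψ`-fixed class of `H¹(N, X)` is restricted from `H¹(G', X)`;
* §3 **`exists_conjMap_eq_of_resLe`** — for an antitone family of closed subgroups `G_n` with `⋂ G_n ⊆ P` and `ψ_n ∈ G_n`, every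
  class restricted from `P` is fixed by some `ψ_n` (compactness).

The sequel `…LocalFactorStructure` builds the tower `G_n` from a character `κ : Γ → ℤ_p` and proves the equivalence.

References: [GreenbergVatsal2000] §2 pp. 16–17, 20–22; [NeukirchSchmidtWingberg2008] (1.6.7), Thm. 7.5.3; [SerreGaloisCohomology1997] I §2.6 (b).
-/

set_option autoImplicit false
-- D-0017: single-problem summit, so `Summit.BirchSwinnertonDyer.BirchSwinnertonDyer.…` repeats a namespace BY DESIGN.
set_option linter.dupNamespace false

noncomputable section

open CategoryTheory Function Topology
open scoped Pointwise
open _root_.Subgroup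
open Literature.NumberTheory.GaloisRepresentations Literature.AnabelianGeometry.AbsoluteAnabelian Literature.GroupTheory
open Literature.NumberTheory.EllipticCurves (subgroupConj subgroupConj_apply_coe subgroupInclusion subgroupInclusion_apply_coe)

namespace Summit.BirchSwinnertonDyer.BirchSwinnertonDyer.Theorems.SignedTransportAtTwo

universe u v

/-! ## §1. Restricted classes are fixed by inner automorphisms and by an open normal subgroup -/

section Inner

variable {R : Type u} [CommRing R] [TopologicalSpace R]
variable {Γ : Type v} [Group Γ] [TopologicalSpace Γ] [IsTopologicalGroup Γ]
variable (X : TopRep.{v} R Γ)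

/-- The module half of the compatible pair computing `conjMap q ∘ resLe` (as in the tree's `conjMap_resSubgroup_aux`). [folklore] -/
theorem conjMap_resLe_aux {N P : Subgroup Γ} [N.Normal] (hNP : N ≤ P) (q : Γ) :
    ∀ x : N, (X.ρ q).comp ((TopRep.res (((subgroupInclusion hNP).comp (subgroupConj N q) : N →ₜ* P) : N →* P)
      (subgroupRep X P)).ρ x) = ((subgroupRep X N).ρ x).comp (X.ρ q) := fun x => by
  ext v
  change X.ρ q (X.ρ (q⁻¹ * x * q) v) = X.ρ x (X.ρ q v)
  rw [mul_assoc, ρ_mul_apply, ρ_apply_ρ_inv_apply, ρ_mul_apply]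

set_option maxHeartbeats 800000 in
/-- **Classes restricted from `P` are fixed by the elements of `P`**: for `N ≤ P ≤ Γ` (`N` normal) and `q ∈ P`,
`conjMap q (res_{P→N} z) = res_{P→N} z` on `H¹` (inner automorphisms of `P` act trivially on `H¹(P, X)`; Serre,
*Corps locaux* VII §5 Prop. 3, in the relative form of the tree's `map_eq_map_of_inner_one`).
[cite: SerreLocalFields1979, VII §5 Prop. 3] -/
theorem conjMap_resLe_eq_of_mem {N P : Subgroup Γ} [N.Normal] (hNP : N ≤ P) {q : Γ} (hq : q ∈ P)
    (zc : continuousCohomology 1 (subgroupRep X P)) :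
    conjMap X N q 1 (resLe X hNP 1 zc) = resLe X hNP 1 zc := by
  have h1 := map_comp_apply_of (X := subgroupRep X P) (Y := subgroupRep X N) (Z := subgroupRep X N)
      (subgroupInclusion hNP) (subgroupConj N q)
      ((subgroupInclusion hNP).comp (subgroupConj N q)) (fun _ => rfl)
      (TopRep.ofHom ⟨ContinuousLinearMap.id R X, fun _ => rfl⟩) (conjRepHom X N q)
      (TopRep.ofHom ⟨X.ρ q, conjMap_resLe_aux X hNP q⟩) (fun _ => rfl) 1 zc
  change ContinuousCohomology.map (subgroupConj N q) (conjRepHom X N q) 1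
      (ContinuousCohomology.map (subgroupInclusion hNP) _ 1 zc) = ContinuousCohomology.map (subgroupInclusion hNP) _ 1 zc
  rw [← h1]
  exact map_eq_map_of_inner_one (X := subgroupRep X P) (⟨q, hq⟩ : P) (subgroupInclusion hNP)
    ((subgroupInclusion hNP).comp (subgroupConj N q))
    (fun x => Subtype.ext (by
      simp only [ContinuousMonoidHom.comp_toFun, subgroupInclusion_apply_coe, subgroupConj_apply_coe,
        Subgroup.coe_mul, Subgroup.coe_inv])) _ _ (fun _ => rfl) zc

end Inner

section OpenStabilizer

variable {Γ : Type u} [Group Γ] [TopologicalSpace Γ] [IsTopologicalGroup Γ] [CompactSpace Γ]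
  [TotallyDisconnectedSpace Γ]
variable {M : Type u} [AddCommGroup M] [TopologicalSpace M] [DiscreteTopology M] (τ : ContinuousRep Γ ℤ M)

/-- **An open normal subgroup fixes a given class of `H¹(N, X)`** (`N ⊴ Γ` closed, `X` DISCRETE): a continuous cocycle
`f` of the compact group `N` has finitely many values, all fixed by an open subgroup `U₀`, and is right-invariant under
`N ∩ V` for an open `V ∋ 1`; an open normal `U ⊆ U₀ ∩ V` then satisfies `(g·f)(x) = g f(g⁻¹xg) = f(x · [x⁻¹g⁻¹xg]) = f(x)`
for `g ∈ U`. (Continuity of the `Γ ⧸ N`-action on `H¹(N, X)` for discrete `X`.) [cite: SerreGaloisCohomology1997, I §2.6 (b)] -/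
theorem exists_openNormalSubgroup_forall_conjMap_eq (N : Subgroup Γ) [N.Normal] (hN : IsClosed (N : Set Γ))
    (yc : continuousCohomology 1 (subgroupRep τ.toTopRep N)) :
    ∃ U : OpenNormalSubgroup Γ, ∀ g : Γ, g ∈ (U : Subgroup Γ) → conjMap τ.toTopRep N g 1 yc = yc := by
  classical
  haveI : CompactSpace N := isCompact_iff_compactSpace.mp hN.isCompact
  obtain ⟨f, rfl⟩ := oneCocycleClass_surjective _ yc
  -- finitely many values, their common stabiliser `U₀`
  have hfin : (Set.range f.1).Finite := (isCompact_range f.1.continuous).finite_of_discrete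
  set U₀ : Set Γ := ⋂ m ∈ Set.range f.1, {g : Γ | τ g m = m} with hU₀
  have hU₀o : IsOpen U₀ := hfin.isOpen_biInter fun m _ => τ.isOpen_setOf_apply_eq m
  have hU₀1 : (1 : Γ) ∈ U₀ := by
    simp only [hU₀, Set.mem_iInter, Set.mem_setOf_eq, map_one, Module.End.one_apply, implies_true]
  -- uniform right-invariance of `f` under a neighbourhood of `1` in `N`
  have hV : ∃ V ∈ 𝓝 (1 : N), ∀ x c : N, c ∈ V → f.1 (x * c) = f.1 x := by
    have hm : ∀ m ∈ Set.range f.1, ∃ V ∈ 𝓝 (1 : N), (f.1 ⁻¹' {m}) * V ⊆ f.1 ⁻¹' {m} := fun m _ =>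
      compact_open_separated_mul_right ((isClosed_discrete {m}).preimage f.1.continuous).isCompact
        ((isOpen_discrete {m}).preimage f.1.continuous) le_rfl
    choose! V hV hVsub using hm
    refine ⟨⋂ m ∈ Set.range f.1, V m, (Filter.biInter_mem hfin).2 fun m hm' => hV m hm', fun x c hc => ?_⟩
    have hx : x ∈ f.1 ⁻¹' {f.1 x} := rfl
    have hc' : c ∈ V (f.1 x) := (Set.mem_iInter₂.1 hc) (f.1 x) ⟨x, rfl⟩
    exact hVsub (f.1 x) ⟨x, rfl⟩ (Set.mul_mem_mul hx hc')
  obtain ⟨V, hV1, hVinv⟩ := hV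
  obtain ⟨W, hW1, hWV⟩ := (mem_nhds_subtype _ _ _).1 hV1
  obtain ⟨W', hW'W, hW'o, h1W'⟩ := mem_nhds_iff.1 hW1
  -- an open normal subgroup inside `U₀ ∩ W'`
  obtain ⟨U, hU⟩ := ProfiniteGrp.exist_openNormalSubgroup_sub_open_nhds_of_one (hU₀o.inter hW'o) ⟨hU₀1, h1W'⟩
  refine ⟨U, fun g hg => ?_⟩
  have hgU₀ : g ∈ U₀ := (hU hg).1
  rw [conjMap_oneCocycleClass]
  congr 1
  apply Subtype.ext
  ext x
  rw [conj_pullback_apply]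
  -- `g⁻¹ x g = x · c` with `c ∈ N ∩ U ⊆ W`
  have hcN : (x : Γ)⁻¹ * g⁻¹ * x * g ∈ N := by
    have h1 : g⁻¹ * (x : Γ) * g ∈ N := by
      have := Subgroup.Normal.conj_mem inferInstance (x : Γ) x.2 g⁻¹
      rwa [inv_inv] at this
    have h2 := N.mul_mem (N.inv_mem x.2) h1
    simpa only [mul_assoc] using h2
  have hcU : (x : Γ)⁻¹ * g⁻¹ * x * g ∈ (U : Subgroup Γ) := by
    have h1 : (x : Γ)⁻¹ * g⁻¹ * ((x : Γ)⁻¹)⁻¹ ∈ (U : Subgroup Γ) :=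
      Subgroup.Normal.conj_mem inferInstance g⁻¹ ((U : Subgroup Γ).inv_mem hg) (x : Γ)⁻¹
    rw [inv_inv] at h1
    exact (U : Subgroup Γ).mul_mem h1 hg
  set c : N := ⟨(x : Γ)⁻¹ * g⁻¹ * x * g, hcN⟩ with hc
  have hconj : subgroupConj N g x = x * c := by
    apply Subtype.ext
    rw [subgroupConj_apply_coe, Subgroup.coe_mul, hc]
    group
  have hcV : c ∈ V := hWV (hW'W (hU hcU).2)
  rw [hconj, hVinv x c hcV]
  -- `g` fixes the value `f x`
  have hfix : τ g (f.1 x) = f.1 x := by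
    have := Set.mem_iInter₂.1 hgU₀ (f.1 x) ⟨x, rfl⟩
    exact this
  exact hfix

end OpenStabilizer

/-! ## §2. (KM4) for torsion discrete coefficients; avatars of subgroups; the core extension on a subgroup -/


section KM4

variable {G : Type u} [Group G] [TopologicalSpace G] [IsTopologicalGroup G] [CompactSpace G] [T2Space G]
  [TotallyDisconnectedSpace G]
variable {M : Type u} [AddCommGroup M] [TopologicalSpace M] [DiscreteTopology M] (τ : ContinuousRep G ℤ M)

omit [T2Space G] in
/-- **(KM4) for `p`-primary discrete coefficients with finite `p^k`-torsion**: if the closed subgroup `C ≤ G` is topologically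
generated by `ψ` and has an open subgroup of every positive index, every `t ∈ M` is the value at `ψ` of a continuous cocycle of `C`
(apply the tree's finite case `exists_contOneCocycles_apply_eq_of_finite` inside the finite `G`-stable level `M[p^k] ∋ t` and push
the cocycle forward along `M[p^k] ↪ M`). [cite: SerreLocalFields1979, XIII §1 Prop. 1] -/
theorem exists_contOneCocycles_apply_eq_of_primary {p : ℕ} (htor : ∀ m : M, ∃ k : ℕ, p ^ k • m = 0)
    (hfin : ∀ k : ℕ, Set.Finite {m : M | p ^ k • m = 0}) (C : Subgroup G) (hC : IsClosed (C : Set G)) {ψ : C}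
    (hdense : Dense (zpowers ψ : Set C)) (hidx : ∀ n : ℕ, 0 < n → ∃ H : Subgroup C, IsOpen (H : Set C) ∧ H.index = n)
    (t : M) : ∃ y : contOneCocycles (subgroupRep τ.toTopRep C), y.1 ψ = t := by
  obtain ⟨k, hk⟩ := htor t
  -- the finite `G`-stable torsion level `B = M[p^k]`
  let B : Submodule ℤ M :=
    { carrier := {m : M | p ^ k • m = 0}
      add_mem' := fun {a b} ha hb => by
        simp only [Set.mem_setOf_eq] at ha hb ⊢
        rw [smul_add, ha, hb, add_zero]
      zero_mem' := by simp
      smul_mem' := fun c {a} ha => by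
        simp only [Set.mem_setOf_eq] at ha ⊢
        rw [smul_comm, ha, smul_zero] }
  haveI : Finite B := (hfin k).to_subtype
  have hstab : ∀ (g : G) (m : M), m ∈ B → τ g m ∈ B := fun g m hm => by
    change p ^ k • τ g m = 0
    rw [← map_nsmul, show p ^ k • m = 0 from hm, map_zero]
  let ρB : Representation ℤ G B :=
    { toFun := fun g => (τ g).restrict (hstab g)
      map_one' := by ext b; simp
      map_mul' := fun g h => by ext b; simp }
  let τB : ContinuousRep G ℤ B :=
    { toRepresentation := ρB
      continuous_smul := by
        refine Continuous.subtype_mk ?_ _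
        exact τ.continuous_smul.comp (continuous_fst.prodMk (continuous_subtype_val.comp continuous_snd)) }
  obtain ⟨yB, hyB⟩ := exists_contOneCocycles_apply_eq_of_finite τB C hC hdense hidx ⟨t, hk⟩
  have hval : ∀ (g : C) (b : B), (((subgroupRep τB.toTopRep C).ρ g b : B) : M) = τ (g : G) (b : M) :=
    fun _ _ => rfl
  refine ⟨⟨(⟨Subtype.val, continuous_subtype_val⟩ : C(B, M)).comp yB.1, fun g h => ?_⟩, ?_⟩
  · have e := congrArg Subtype.val (yB.2 g h)
    rw [Submodule.coe_add, hval] at e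
    exact e
  · change ((yB.1 ψ : B) : M) = t
    rw [hyB]

end KM4

section Core

variable {Γ : Type u} [Group Γ] [TopologicalSpace Γ] [IsTopologicalGroup Γ] [CompactSpace Γ] [T2Space Γ]
  [TotallyDisconnectedSpace Γ]
variable {M : Type u} [AddCommGroup M] [TopologicalSpace M] [DiscreteTopology M] (τ : ContinuousRep Γ ℤ M)

omit [T2Space Γ] in
/-- **The core extension on a subgroup.** `Γ` profinite, `N ⊴ Γ` closed, `G' ≤ Γ` closed containing `N` and a closed
subgroup `C` which is free procyclic and topologically generated by `ψ`, `r : Γ → Γ` a continuous homomorphism which on `G'`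
takes values in `C`, is the identity on `C` and has kernel `N ∩ G'` (so `G' = N ⋊ C`), and `X` a discrete `p`-primary
`Γ`-module with finite `p^k`-torsion. Then every class of `H¹(N, X)` fixed by `ψ` is the restriction of a class of
`H¹(G', X)` — the tree's `H²`-free extension theorem `exists_resSubgroup_eq_of_conjMap_eq` run inside the profinite group
`G'` and transported back along the avatar `N ≅ N.subgroupOf G'`. [cite: NeukirchSchmidtWingberg2008, (1.6.7)]
[cite: SerreGaloisCohomology1997, I §2.6 (b)] -/
theorem exists_resLe_eq_of_conjMap_eq_subgroup {p : ℕ} (htor : ∀ m : M, ∃ k : ℕ, p ^ k • m = 0)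
    (hfin : ∀ k : ℕ, Set.Finite {m : M | p ^ k • m = 0})
    {N G' C : Subgroup Γ} [N.Normal] (hG' : IsClosed (G' : Set Γ))
    (hNG' : N ≤ G') (hCG' : C ≤ G') (hC : IsClosed (C : Set Γ))
    (hfreeC : FundamentalExtension.IsFreeProcyclic C)
    (r : Γ →ₜ* Γ) (hrC : ∀ g ∈ G', r g ∈ C) (hrid : ∀ c ∈ C, r c = c) (hker : ∀ g ∈ G', r g = 1 ↔ g ∈ N)
    {ψ : Γ} (hψ : ψ ∈ C) (hdense : Dense (zpowers (⟨ψ, hψ⟩ : C) : Set C))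
    (yc : continuousCohomology 1 (subgroupRep τ.toTopRep N)) (hinv : conjMap τ.toTopRep N ψ 1 yc = yc) :
    ∃ xc : continuousCohomology 1 (subgroupRep τ.toTopRep G'), resLe τ.toTopRep hNG' 1 xc = yc := by
  haveI : CompactSpace G' := isCompact_iff_compactSpace.mp hG'.isCompact
  -- the data inside the profinite group `G'`
  set X' : TopRep ℤ G' := subgroupRep τ.toTopRep G' with hX'
  set N' : Subgroup G' := N.subgroupOf G' with hN'
  set C' : Subgroup G' := C.subgroupOf G' with hC'
  have hXc : Continuous fun q : G' × M => X'.ρ q.1 q.2 :=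
    τ.continuous_smul.comp ((continuous_subtype_val.comp continuous_fst).prodMk continuous_snd)
  let r' : G' →ₜ* G' :=
    { toFun := fun x => ⟨r x, hCG' (hrC x x.2)⟩
      map_one' := Subtype.ext (by simp)
      map_mul' := fun x y => Subtype.ext (by simp)
      continuous_toFun := Continuous.subtype_mk (r.continuous_toFun.comp continuous_subtype_val) _ }
  have hrC' : ∀ x : G', r' x ∈ C' := fun x => Subgroup.mem_subgroupOf.2 (hrC x x.2)
  have hrid' : ∀ c ∈ C', r' c = c := fun c hc => Subtype.ext (hrid c (Subgroup.mem_subgroupOf.1 hc))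
  have hker' : ∀ x : G', r' x = 1 ↔ x ∈ N' := fun x => by
    rw [hN', Subgroup.mem_subgroupOf, ← hker x x.2]
    exact ⟨fun h1 => congrArg Subtype.val h1, fun h1 => Subtype.ext h1⟩
  -- density and free procyclicity transported to the avatar `C' ≅ C`
  let e : C' ≃ₜ* C :=
    { Subgroup.subgroupOfEquivOfLe hCG' with
      continuous_toFun := Continuous.subtype_mk (continuous_subtype_val.comp continuous_subtype_val) _
      continuous_invFun := Continuous.subtype_mk (Continuous.subtype_mk continuous_subtype_val _) _ }
  set ψ' : C' := ⟨⟨ψ, hCG' hψ⟩, Subgroup.mem_subgroupOf.2 hψ⟩ with hψ'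
  have heψ : e.symm ⟨ψ, hψ⟩ = ψ' := rfl
  have hdense' : Dense (zpowers ψ' : Set C') := by
    rw [← heψ]; exact dense_zpowers_map_continuousMulEquiv e.symm hdense
  have hfree' : FundamentalExtension.IsFreeProcyclic C' := hfreeC.of_continuousMulEquiv e.symm
  have hC'c : IsClosed (C' : Set G') := by
    have : (C' : Set G') = Subtype.val ⁻¹' (C : Set Γ) := by
      ext x; simp [hC', Subgroup.mem_subgroupOf]
    rw [this]; exact hC.preimage continuous_subtype_val
  -- (KM4) on `C'` for the restricted representation
  let τ' : ContinuousRep G' ℤ M := τ.restrict (subgroupSubtypeHom G')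
  have hKM4 : ∀ t : M, ∃ y : contOneCocycles (subgroupRep X' C'), y.1 ψ' = t := fun t =>
    exists_contOneCocycles_apply_eq_of_primary τ' htor hfin C' hC'c hdense' hfree'.exists_isOpen_index t
  -- the avatar map `θ : N' → N` and the transport `S = H¹(θ)`; `S yc` is invariant under `ψ'`
  let θ : N' →ₜ* N :=
    { toFun := fun x => ⟨((x : G') : Γ), Subgroup.mem_subgroupOf.1 x.2⟩
      map_one' := rfl
      map_mul' := fun _ _ => rfl
      continuous_toFun := Continuous.subtype_mk (continuous_subtype_val.comp continuous_subtype_val) _ }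
  have hθsurj : Surjective θ := fun y => ⟨⟨⟨y, hNG' y.2⟩, Subgroup.mem_subgroupOf.2 y.2⟩, rfl⟩
  set S := ContinuousCohomology.map θ
    (𝟙 (TopRep.res ((θ : N.subgroupOf G' →ₜ* N) : N.subgroupOf G' →* N) (subgroupRep τ.toTopRep N))) 1 with hS
  have hSinj : Injective S := map_one_injective_of_surjective _ θ hθsurj
  -- `S` commutes with restriction from `G'` and intertwines the conjugation actions (same cocycles)
  have hS_res : ∀ xc : continuousCohomology 1 X', S (resLe τ.toTopRep hNG' 1 xc) = resSubgroup X' N' 1 xc := by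
    intro xc
    obtain ⟨f, rfl⟩ := oneCocycleClass_surjective _ xc
    rw [hS, resLe_oneCocycleClass, map_oneCocycleClass, resSubgroup_oneCocycleClass]
    exact congrArg _ (Subtype.ext (ContinuousMap.ext fun _ => rfl))
  have hS_conj : ∀ (g : G') (y : continuousCohomology 1 (subgroupRep τ.toTopRep N)),
      S (conjMap τ.toTopRep N (g : Γ) 1 y) = conjMap X' N' g 1 (S y) := by
    intro g y
    obtain ⟨f, rfl⟩ := oneCocycleClass_surjective _ y
    rw [hS, conjMap_oneCocycleClass, map_oneCocycleClass, map_oneCocycleClass]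
    refine Eq.trans ?_ (conjMap_oneCocycleClass (subgroupRep τ.toTopRep G') (N.subgroupOf G') g _).symm
    refine congrArg _ (Subtype.ext (ContinuousMap.ext fun x => ?_))
    change τ (g : Γ) (f.1 (subgroupConj N (g : Γ) (θ x))) =
      τ (g : Γ) (f.1 (θ (subgroupConj (N.subgroupOf G') g x)))
    congr 2
  have hinv' : conjMap X' N' ((⟨ψ, hCG' hψ⟩ : G') : G') 1 (S yc) = S yc := by
    have := hS_conj ⟨ψ, hCG' hψ⟩ yc
    rw [hinv] at this
    exact this.symm
  obtain ⟨xc, hxc⟩ := exists_resSubgroup_eq_of_conjMap_eq X' hXc r' hrC' hrid' hker' (ψ := ψ') hdense' hKM4 (S yc)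
    hinv'
  refine ⟨xc, hSinj ?_⟩
  rw [hS_res xc]
  exact hxc

end Core

/-! ## §3. The `⊆` direction: restricted classes are eventually fixed -/

section Subset

variable {Γ : Type u} [Group Γ] [TopologicalSpace Γ] [IsTopologicalGroup Γ] [CompactSpace Γ]
  [TotallyDisconnectedSpace Γ]
variable {M : Type u} [AddCommGroup M] [TopologicalSpace M] [DiscreteTopology M] (τ : ContinuousRep Γ ℤ M)

/-- **Restricted classes are fixed by the deep members of a shrinking family.** `N ≤ P` (`N ⊴ Γ` closed), `G : ℕ → Subgroup Γ`
an antitone family of CLOSED subgroups whose intersection lies in `P`, `ψ n ∈ G n`: every class of `H¹(N, X)` restricted from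
`H¹(P, X)` is fixed by `ψ n` for some `n` (it is fixed by `P` and by an open normal `U`; by compactness `G n ⊆ U·P` for
`n ≫ 0`). [cite: SerreGaloisCohomology1997, I §2.6 (b)] -/
theorem exists_conjMap_eq_of_resLe {N P : Subgroup Γ} [N.Normal] (hN : IsClosed (N : Set Γ)) (hNP : N ≤ P)
    (G : ℕ → Subgroup Γ) (hGanti : Antitone G) (hGclosed : ∀ n, IsClosed (G n : Set Γ))
    (hGP : ∀ x : Γ, (∀ n, x ∈ G n) → x ∈ P) (ψ : ℕ → Γ) (hψ : ∀ n, ψ n ∈ G n)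
    (zc : continuousCohomology 1 (subgroupRep τ.toTopRep P)) :
    ∃ n : ℕ, conjMap τ.toTopRep N (ψ n) 1 (resLe τ.toTopRep hNP 1 zc) = resLe τ.toTopRep hNP 1 zc := by
  obtain ⟨U, hU⟩ := exists_openNormalSubgroup_forall_conjMap_eq τ N hN (resLe τ.toTopRep hNP 1 zc)
  -- the open subgroup `U ⊔ P = U·P ⊇ P`
  set S : Subgroup Γ := (U : Subgroup Γ) ⊔ P with hSdef
  have hSopen : IsOpen (S : Set Γ) := Subgroup.isOpen_mono (le_sup_left : (U : Subgroup Γ) ≤ S) U.isOpen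
  have hmem : ∀ x ∈ ⋂ n, (G n : Set Γ), (S : Set Γ) ∈ 𝓝 x := fun x hx =>
    hSopen.mem_nhds (Subgroup.mem_sup_right (hGP x (by simpa [Set.mem_iInter] using hx)))
  have hdir : Directed (· ⊇ ·) fun n => (G n : Set Γ) := fun i j =>
    ⟨max i j, hGanti (le_max_left i j), hGanti (le_max_right i j)⟩
  obtain ⟨n, hn⟩ := exists_subset_nhds_of_compactSpace hdir hGclosed hmem
  refine ⟨n, ?_⟩
  have hψS : ψ n ∈ (S : Set Γ) := hn (hψ n)
  rw [hSdef, Subgroup.normal_mul] at hψS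
  obtain ⟨u, hu, q, hq, huq⟩ := Set.mem_mul.1 hψS
  rw [← huq, ← conjMap_conjMap, conjMap_resLe_eq_of_mem τ.toTopRep hNP hq, hU u hu]

end Subset

end Summit.BirchSwinnertonDyer.BirchSwinnertonDyer.Theorems.SignedTransportAtTwo

end
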